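import Literature.ComputerArithmetic.Shewchuk1997.Compress
import Mathlib.Tactic.Linarith
import Mathlib.Tactic.Ring
import Mathlib.Tactic.NormNum

/-!
# COMPRESS may need three passes — `compress ∘ compress` is not idempotent either (p = 3, RNE)

[cite: Shewchuk1997, §2.7 Theorem 23 p. 331–333 (COMPRESS, Fig. 17); BoldoEtAl2023, §2.2
(round-to-nearest-even, the tie rule)]

`CompressNotIdempotent` / `CompressNotIdempotentPrecTwo` show that one extra COMPRESS pass can
change a COMPRESS output.  Here: even TWO passes do not reach a fixed point in general.  At
precision `p = 3`, round-to-nearest-EVEN, `emin ≤ 0`, the nonoverlapping, increasing, zero-free,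
all-positive expansion `e₀ = ⟨3, 8, 160, 256, 2048⟩` (value `2475`) gives
`COMPRESS e₀ = ⟨3, −24, −64, 2560⟩`, `COMPRESS² e₀ = ⟨−1, −4, −80, 2560⟩`,
`COMPRESS³ e₀ = ⟨−5, −80, 2560⟩` — three passes, three different outputs (lengths 4, 4, 3), so
neither `COMPRESS` nor `COMPRESS ∘ COMPRESS` is idempotent (`compress_three_passes_prec_three`,
`compress_twice_ne_thrice_prec_three`).  Roundings used: the ties `RN(2304) = 2048`,
`RN(416) = 384`, `RN(−88) = −96` (even kept), `RN(11) = 12` (odd `5` bumped), and the non-ties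
`RN(43) = 40`, `RN(424) = 448`, `RN(2496) = 2560`, `RN(−84) = −80`, `RN(2480) = 2560`,
`RN(−85) = −80`.  Found by exhaustive search in an integer model of the tree's `compress` (no
3-pass input at `p = 3` with ≤ 4 components below `2^14`, nor at `p = 2` with ≤ 6 components
below `2^11`; this is the smallest 5-component one at `p = 3`).
HONEST FRAMING: a property of the printed algorithm at a toy precision, kernel-checked from the
definitions; Theorem 23 itself (Σ preserved, output nonoverlapping, top ≈ Σ) is untouched.
-/

namespace Summit.Ventures.CertifiedArithmetic.Expansions

open Literature.ComputerArithmetic.JeannerodRump2018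
open Literature.ComputerArithmetic.BoldoJeannerodMelquiondMuller2023 hiding twoSum twoSum_fst
open Literature.ComputerArithmetic.Shewchuk1997

variable {emin : ℤ}

/-- `2^m ≤ |t| < 2^(m+1)`, `emin ≤ m − p + 1` ⟹ `ulp(t) = 2^(m−p+1)`.
[cite: BoldoEtAl2023, §2.1] -/
private theorem ulp_eq_of_binade' {p : ℕ} {t : ℚ} {m : ℤ} (hm : emin ≤ m - p + 1)
    (h1 : (2 : ℚ) ^ m ≤ |t|) (h2 : |t| < (2 : ℚ) ^ (m + 1)) :
    ulp p emin t = (2 : ℚ) ^ (m - p + 1) := by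
  have hpos : 0 < |t| := lt_of_lt_of_le (zpow_pos (by norm_num) _) h1
  have ht0 : t ≠ 0 := abs_pos.mp hpos
  have hlo : m ≤ Int.log 2 |t| :=
    (Int.zpow_le_iff_le_log (b := 2) (by norm_num) hpos).mp (by exact_mod_cast h1)
  have hhi : Int.log 2 |t| < m + 1 :=
    (Int.lt_zpow_iff_log_lt (b := 2) (by norm_num) hpos).mp (by exact_mod_cast h2)
  have hlog : Int.log 2 |t| = m := le_antisymm (by omega) hlo
  rw [ulp_of_ne_zero ht0, hlog, max_eq_right hm]

/-- `t = (N + r)·ulp(t)` with `0 ≤ r < 1` gives `⌊t/ulp(t)⌋ = N`.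
[cite: BoldoEtAl2023, §2.2] -/
private theorem rne_floor' {p : ℕ} {t U r : ℚ} {N : ℤ} (hU : ulp p emin t = U) (hUpos : 0 < U)
    (ht : t = ((N : ℚ) + r) * U) (hr0 : 0 ≤ r) (hr1 : r < 1) : ⌊t / ulp p emin t⌋ = N := by
  rw [hU, Int.floor_eq_iff, ht, mul_div_assoc, div_self hUpos.ne', mul_one]
  constructor <;> linarith

/-- `RN_e` below the midpoint: `r < ½` ⟹ `RN_e(t) = N·ulp(t)`. [cite: BoldoEtAl2023, §2.2] -/
private theorem rne_down' {p : ℕ} {t U r : ℚ} {N : ℤ} (hU : ulp p emin t = U) (hUpos : 0 < U)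
    (ht : t = ((N : ℚ) + r) * U) (hr0 : 0 ≤ r) (hr1 : r < 1) (hr : r < 1 / 2) :
    roundTiesEven p emin t = (N : ℚ) * U := by
  have hfl := rne_floor' hU hUpos ht hr0 hr1
  have e1 : t - (N : ℚ) * U = r * U := by rw [ht]; ring
  have e2 : ((N : ℚ) + 1) * U - t = (1 - r) * U := by rw [ht]; ring
  have hlt : r * U < (1 - r) * U := mul_lt_mul_of_pos_right (by linarith) hUpos
  unfold roundTiesEven
  rw [hfl, hU, e1, e2, if_pos hlt]

/-- `RN_e` above the midpoint: `r > ½` ⟹ `RN_e(t) = (N+1)·ulp(t)`.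
[cite: BoldoEtAl2023, §2.2] -/
private theorem rne_up' {p : ℕ} {t U r : ℚ} {N : ℤ} (hU : ulp p emin t = U) (hUpos : 0 < U)
    (ht : t = ((N : ℚ) + r) * U) (hr0 : 0 ≤ r) (hr1 : r < 1) (hr : 1 / 2 < r) :
    roundTiesEven p emin t = ((N : ℚ) + 1) * U := by
  have hfl := rne_floor' hU hUpos ht hr0 hr1
  have e1 : t - (N : ℚ) * U = r * U := by rw [ht]; ring
  have e2 : ((N : ℚ) + 1) * U - t = (1 - r) * U := by rw [ht]; ring
  have hgt : (1 - r) * U < r * U := mul_lt_mul_of_pos_right (by linarith) hUpos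
  unfold roundTiesEven
  rw [hfl, hU, e1, e2, if_neg (not_lt.mpr hgt.le), if_pos hgt]

/-- `RN_e` AT the midpoint, even `N`: `RN_e(t) = N·ulp(t)` — the printed tie rule.
[cite: BoldoEtAl2023, §2.2 (p. 212, "the one whose integral significand is even")] -/
private theorem rne_tie_even' {p : ℕ} {t U : ℚ} {N : ℤ} (hU : ulp p emin t = U)
    (hUpos : 0 < U) (ht : t = ((N : ℚ) + 1 / 2) * U) (hN : Even N) :
    roundTiesEven p emin t = (N : ℚ) * U := by
  have hfl := rne_floor' hU hUpos ht (by norm_num) (by norm_num)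
  have e1 : t - (N : ℚ) * U = 1 / 2 * U := by rw [ht]; ring
  have e2 : ((N : ℚ) + 1) * U - t = 1 / 2 * U := by rw [ht]; ring
  unfold roundTiesEven
  rw [hfl, hU, e1, e2, if_neg (lt_irrefl _), if_neg (lt_irrefl _), if_pos hN]

/-- `RN_e` AT the midpoint, odd `N`: `RN_e(t) = (N+1)·ulp(t)` (the even neighbour).
[cite: BoldoEtAl2023, §2.2 (p. 212)] -/
private theorem rne_tie_odd' {p : ℕ} {t U : ℚ} {N : ℤ} (hU : ulp p emin t = U)
    (hUpos : 0 < U) (ht : t = ((N : ℚ) + 1 / 2) * U) (hN : Odd N) :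
    roundTiesEven p emin t = ((N : ℚ) + 1) * U := by
  have hfl := rne_floor' hU hUpos ht (by norm_num) (by norm_num)
  have e1 : t - (N : ℚ) * U = 1 / 2 * U := by rw [ht]; ring
  have e2 : ((N : ℚ) + 1) * U - t = 1 / 2 * U := by rw [ht]; ring
  unfold roundTiesEven
  rw [hfl, hU, e1, e2, if_neg (lt_irrefl _), if_neg (lt_irrefl _),
    if_neg (Int.not_even_iff_odd.mpr hN)]

/-- FAST-TWO-SUM evaluated: floats `|b| ≤ |a|`, `fl(a + b) = s` ⟹ `(s, a + b − s)`.
[cite: Shewchuk1997, §2.3 Theorem 6] -/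
private theorem f2s_eq' {p : ℕ} {fl : ℚ → ℚ} (hp : 1 ≤ p) (hfl : IsRoundNearest p emin fl)
    {a b s : ℚ} (ha : IsFloat p emin a) (hb : IsFloat p emin b) (hab : |b| ≤ |a|)
    (hs : fl (a + b) = s) : fastTwoSum fl a b = (s, a + b - s) := by
  obtain ⟨h1, -, h2, -⟩ := fastTwoSum_exact hp hfl ha hb hab
  exact Prod.ext (by rw [h1, hs]) (by rw [h2, hs])

/-- `RN_e(2304) = 2048` (`p = 3`, `ulp = 512`, tie, even kept). [cite: BoldoEtAl2023, §2.2] -/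
theorem p3_rne_2304 (he : emin ≤ 0) : roundTiesEven 3 emin (2304 : ℚ) = 2048 := by
  have hU : ulp 3 emin (2304 : ℚ) = 512 := by
    rw [ulp_eq_of_binade' (p := 3) (m := 11) (by omega) (by norm_num) (by norm_num)]
    norm_num
  rw [rne_tie_even' hU (by norm_num) (N := 4) (by norm_num) ⟨2, by norm_num⟩]; norm_num

/-- `RN_e(416) = 384` (`p = 3`, `ulp = 64`, tie, even kept). [cite: BoldoEtAl2023, §2.2] -/
theorem p3_rne_416 (he : emin ≤ 0) : roundTiesEven 3 emin (416 : ℚ) = 384 := by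
  have hU : ulp 3 emin (416 : ℚ) = 64 := by
    rw [ulp_eq_of_binade' (p := 3) (m := 8) (by omega) (by norm_num) (by norm_num)]
    norm_num
  rw [rne_tie_even' hU (by norm_num) (N := 6) (by norm_num) ⟨3, by norm_num⟩]; norm_num

/-- `RN_e(43) = 40` (`p = 3`, `ulp = 8`, below midpoint). [cite: BoldoEtAl2023, §2.2] -/
theorem p3_rne_43 (he : emin ≤ 0) : roundTiesEven 3 emin (43 : ℚ) = 40 := by
  have hU : ulp 3 emin (43 : ℚ) = 8 := by
    rw [ulp_eq_of_binade' (p := 3) (m := 5) (by omega) (by norm_num) (by norm_num)]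
    norm_num
  rw [rne_down' hU (by norm_num) (N := 5) (r := 3 / 8) (by norm_num) (by norm_num) (by norm_num)
    (by norm_num)]; norm_num

/-- `RN_e(424) = 448` (`p = 3`, `ulp = 64`, above midpoint). [cite: BoldoEtAl2023, §2.2] -/
theorem p3_rne_424 (he : emin ≤ 0) : roundTiesEven 3 emin (424 : ℚ) = 448 := by
  have hU : ulp 3 emin (424 : ℚ) = 64 := by
    rw [ulp_eq_of_binade' (p := 3) (m := 8) (by omega) (by norm_num) (by norm_num)]
    norm_num
  rw [rne_up' hU (by norm_num) (N := 6) (r := 5 / 8) (by norm_num) (by norm_num) (by norm_num)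
    (by norm_num)]; norm_num

/-- `RN_e(2496) = 2560` (`p = 3`, `ulp = 512`, above midpoint). [cite: BoldoEtAl2023, §2.2] -/
theorem p3_rne_2496 (he : emin ≤ 0) : roundTiesEven 3 emin (2496 : ℚ) = 2560 := by
  have hU : ulp 3 emin (2496 : ℚ) = 512 := by
    rw [ulp_eq_of_binade' (p := 3) (m := 11) (by omega) (by norm_num) (by norm_num)]
    norm_num
  rw [rne_up' hU (by norm_num) (N := 4) (r := 7 / 8) (by norm_num) (by norm_num) (by norm_num)
    (by norm_num)]; norm_num

/-- `RN_e(-88) = -96` (`p = 3`, `ulp = 16`, tie, even kept). [cite: BoldoEtAl2023, §2.2] -/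
theorem p3_rne_neg88 (he : emin ≤ 0) : roundTiesEven 3 emin (-88 : ℚ) = -96 := by
  have hU : ulp 3 emin (-88 : ℚ) = 16 := by
    rw [ulp_eq_of_binade' (p := 3) (m := 6) (by omega) (by norm_num) (by norm_num)]
    norm_num
  rw [rne_tie_even' hU (by norm_num) (N := -6) (by norm_num) ⟨-3, by norm_num⟩]; norm_num

/-- `RN_e(11) = 12` (`p = 3`, `ulp = 2`, tie, odd bumped). [cite: BoldoEtAl2023, §2.2] -/
theorem p3_rne_11 (he : emin ≤ 0) : roundTiesEven 3 emin (11 : ℚ) = 12 := by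
  have hU : ulp 3 emin (11 : ℚ) = 2 := by
    rw [ulp_eq_of_binade' (p := 3) (m := 3) (by omega) (by norm_num) (by norm_num)]
    norm_num
  rw [rne_tie_odd' hU (by norm_num) (N := 5) (by norm_num) ⟨2, by norm_num⟩]; norm_num

/-- `RN_e(-84) = -80` (`p = 3`, `ulp = 16`, above midpoint). [cite: BoldoEtAl2023, §2.2] -/
theorem p3_rne_neg84 (he : emin ≤ 0) : roundTiesEven 3 emin (-84 : ℚ) = -80 := by
  have hU : ulp 3 emin (-84 : ℚ) = 16 := by
    rw [ulp_eq_of_binade' (p := 3) (m := 6) (by omega) (by norm_num) (by norm_num)]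
    norm_num
  rw [rne_up' hU (by norm_num) (N := -6) (r := 3 / 4) (by norm_num) (by norm_num) (by norm_num)
    (by norm_num)]; norm_num

/-- `RN_e(2480) = 2560` (`p = 3`, `ulp = 512`, above midpoint). [cite: BoldoEtAl2023, §2.2] -/
theorem p3_rne_2480 (he : emin ≤ 0) : roundTiesEven 3 emin (2480 : ℚ) = 2560 := by
  have hU : ulp 3 emin (2480 : ℚ) = 512 := by
    rw [ulp_eq_of_binade' (p := 3) (m := 11) (by omega) (by norm_num) (by norm_num)]
    norm_num
  rw [rne_up' hU (by norm_num) (N := 4) (r := 27 / 32) (by norm_num) (by norm_num) (by norm_num)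
    (by norm_num)]; norm_num

/-- `RN_e(-85) = -80` (`p = 3`, `ulp = 16`, above midpoint). [cite: BoldoEtAl2023, §2.2] -/
theorem p3_rne_neg85 (he : emin ≤ 0) : roundTiesEven 3 emin (-85 : ℚ) = -80 := by
  have hU : ulp 3 emin (-85 : ℚ) = 16 := by
    rw [ulp_eq_of_binade' (p := 3) (m := 6) (by omega) (by norm_num) (by norm_num)]
    norm_num
  rw [rne_up' hU (by norm_num) (N := -6) (r := 11 / 16) (by norm_num) (by norm_num) (by norm_num)
    (by norm_num)]; norm_num

/-- The floats of the witness at `p = 3` (`emin ≤ 0`), in order of use: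
`2048, 256, 160, 32, 8, 40, 3, 384, 448, 2560, −64, −24, 12, −1, −96, −80, −4, −5`.
[cite: JeannerodRump2018, §1 (the set F)] -/
theorem p3_isFloat (he : emin ≤ 0) :
    IsFloat 3 emin (2048 : ℚ) ∧ IsFloat 3 emin (256 : ℚ) ∧ IsFloat 3 emin (160 : ℚ) ∧
      IsFloat 3 emin (32 : ℚ) ∧ IsFloat 3 emin (8 : ℚ) ∧ IsFloat 3 emin (40 : ℚ) ∧
      IsFloat 3 emin (3 : ℚ) ∧ IsFloat 3 emin (384 : ℚ) ∧ IsFloat 3 emin (448 : ℚ) ∧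
      IsFloat 3 emin (2560 : ℚ) ∧ IsFloat 3 emin (-64 : ℚ) ∧ IsFloat 3 emin (-24 : ℚ) ∧
      IsFloat 3 emin (12 : ℚ) ∧ IsFloat 3 emin (-1 : ℚ) ∧ IsFloat 3 emin (-96 : ℚ) ∧
      IsFloat 3 emin (-80 : ℚ) ∧ IsFloat 3 emin (-4 : ℚ) ∧ IsFloat 3 emin (-5 : ℚ) :=
  ⟨⟨1, 11, by norm_num, by omega, by norm_num⟩, ⟨1, 8, by norm_num, by omega, by norm_num⟩,
    ⟨5, 5, by norm_num, by omega, by norm_num⟩, ⟨1, 5, by norm_num, by omega, by norm_num⟩,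
    ⟨1, 3, by norm_num, by omega, by norm_num⟩, ⟨5, 3, by norm_num, by omega, by norm_num⟩,
    ⟨3, 0, by norm_num, he, by norm_num⟩, ⟨3, 7, by norm_num, by omega, by norm_num⟩,
    ⟨7, 6, by norm_num, by omega, by norm_num⟩, ⟨5, 9, by norm_num, by omega, by norm_num⟩,
    ⟨-1, 6, by norm_num, by omega, by norm_num⟩, ⟨-3, 3, by norm_num, by omega, by norm_num⟩,
    ⟨3, 2, by norm_num, by omega, by norm_num⟩, ⟨-1, 0, by norm_num, he, by norm_num⟩,
    ⟨-3, 5, by norm_num, by omega, by norm_num⟩, ⟨-5, 4, by norm_num, by omega, by norm_num⟩,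
    ⟨-1, 2, by norm_num, by omega, by norm_num⟩, ⟨-5, 0, by norm_num, he, by norm_num⟩⟩

/-- `⟨3, 8, 160, 256, 2048⟩` is a nonoverlapping expansion (each component lies on a grid `2^s`
with every lower component below `2^s` in magnitude). [cite: Shewchuk1997, §2.1] -/
theorem p3_isExpansion : IsExpansion 1 ([3, 8, 160, 256, 2048] : List ℚ) := by
  have b : ∀ (x y : ℚ) (s r : ℤ), y = (r : ℚ) * 2 ^ s → 1 * |x| < (2 : ℚ) ^ s →
      Below 1 x y := fun x y s r h1 h2 => ⟨s, ⟨r, h1⟩, h2⟩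
  refine List.Pairwise.cons ?_ (List.Pairwise.cons ?_ (List.Pairwise.cons ?_
    (List.Pairwise.cons ?_ (List.pairwise_singleton _ _))))
  · intro y hy
    simp only [List.mem_cons, List.not_mem_nil, or_false] at hy
    rcases hy with rfl | rfl | rfl | rfl
    · exact b 3 8 3 1 (by norm_num) (by norm_num)
    · exact b 3 160 5 5 (by norm_num) (by norm_num)
    · exact b 3 256 8 1 (by norm_num) (by norm_num)
    · exact b 3 2048 11 1 (by norm_num) (by norm_num)
  · intro y hy
    simp only [List.mem_cons, List.not_mem_nil, or_false] at hy
    rcases hy with rfl | rfl | rfl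
    · exact b 8 160 5 5 (by norm_num) (by norm_num)
    · exact b 8 256 8 1 (by norm_num) (by norm_num)
    · exact b 8 2048 11 1 (by norm_num) (by norm_num)
  · intro y hy
    simp only [List.mem_cons, List.not_mem_nil, or_false] at hy
    rcases hy with rfl | rfl
    · exact b 160 256 8 1 (by norm_num) (by norm_num)
    · exact b 160 2048 11 1 (by norm_num) (by norm_num)
  · intro y hy
    simp only [List.mem_cons, List.not_mem_nil, or_false] at hy
    subst hy
    exact b 256 2048 9 4 (by norm_num) (by norm_num)

/-- **Pass 1** (`p = 3`, RNE): `COMPRESS⟨3, 8, 160, 256, 2048⟩ = ⟨3, −24, −64, 2560⟩`.  Downward: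
`(2048, 256) ↦ (2048, 256)` [tie], `(256, 160) ↦ (384, 32)` [tie], `(32, 8) ↦ (40, 0)` [absorb],
`(40, 3) ↦ (40, 3)`; upward from `3`: emits `3`, `(384, 40) ↦ (448, −24)`,
`(2048, 448) ↦ (2560, −64)`. [cite: Shewchuk1997, §2.7 p. 332 (COMPRESS), §2.3 Theorem 6] -/
theorem compress_p3_pass1 (he : emin ≤ 0) :
    compress (roundTiesEven 3 emin) [3, 8, 160, 256, 2048] = [3, -24, -64, 2560] := by
  have hfl := isRoundNearest_roundTiesEven (p := 3) (emin := emin) (by norm_num)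
  obtain ⟨f2048, f256, f160, f32, f8, f40, f3, f384, f448, -⟩ := p3_isFloat he
  have F1 : fastTwoSum (roundTiesEven 3 emin) 2048 256 = (2048, 256) := by
    rw [f2s_eq' (by norm_num) (s := 2048) hfl f2048 f256 (by norm_num)
      (by rw [show (2048 : ℚ) + 256 = 2304 by norm_num]; exact p3_rne_2304 he)]
    norm_num
  have F2 : fastTwoSum (roundTiesEven 3 emin) 256 160 = (384, 32) := by
    rw [f2s_eq' (by norm_num) (s := 384) hfl f256 f160 (by norm_num)
      (by rw [show (256 : ℚ) + 160 = 416 by norm_num]; exact p3_rne_416 he)]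
    norm_num
  have F3 : fastTwoSum (roundTiesEven 3 emin) 32 8 = (40, 0) := by
    rw [f2s_eq' (by norm_num) (s := 40) hfl f32 f8 (by norm_num)
      (by rw [show (32 : ℚ) + 8 = 40 by norm_num]; exact roundTiesEven_eq_self (by norm_num) f40)]
    norm_num
  have F4 : fastTwoSum (roundTiesEven 3 emin) 40 3 = (40, 3) := by
    rw [f2s_eq' (by norm_num) (s := 40) hfl f40 f3 (by norm_num)
      (by rw [show (40 : ℚ) + 3 = 43 by norm_num]; exact p3_rne_43 he)]
    norm_num
  have F5 : fastTwoSum (roundTiesEven 3 emin) 384 40 = (448, -24) := by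
    rw [f2s_eq' (by norm_num) (s := 448) hfl f384 f40 (by norm_num)
      (by rw [show (384 : ℚ) + 40 = 424 by norm_num]; exact p3_rne_424 he)]
    norm_num
  have F6 : fastTwoSum (roundTiesEven 3 emin) 2048 448 = (2560, -64) := by
    rw [f2s_eq' (by norm_num) (s := 2560) hfl f2048 f448 (by norm_num)
      (by rw [show (2048 : ℚ) + 448 = 2496 by norm_num]; exact p3_rne_2496 he)]
    norm_num
  have hD : compressDown (roundTiesEven 3 emin) 2048 [256, 160, 8, 3] = ([2048, 384, 40], 3) := by
    rw [compressDown_cons_of_ne_zero (by rw [F1]; norm_num), F1]; simp only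
    rw [compressDown_cons_of_ne_zero (by rw [F2]; norm_num), F2]; simp only
    rw [compressDown_cons_of_eq_zero (by rw [F3]), F3]; simp only
    rw [compressDown_cons_of_ne_zero (by rw [F4]; norm_num), F4]
    simp
  have hc : compress (roundTiesEven 3 emin) [3, 8, 160, 256, 2048] =
      compressUp (roundTiesEven 3 emin) 3 [40, 384, 2048] := by
    simp only [compress, List.reverse_cons, List.reverse_nil, List.nil_append, List.cons_append,
      hD]
  rw [hc, compressUp_cons_of_ne_zero (by rw [F4]; norm_num), F4]; simp only
  rw [compressUp_cons_of_ne_zero (by rw [F5]; norm_num), F5]; simp only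
  rw [compressUp_cons_of_ne_zero (by rw [F6]; norm_num), F6]
  simp

/-- **Pass 2** (`p = 3`, RNE): `COMPRESS⟨3, −24, −64, 2560⟩ = ⟨−1, −4, −80, 2560⟩`.  Downward:
`(2560, −64) ↦ (2560, −64)`, `(−64, −24) ↦ (−96, 8)` [tie], `(8, 3) ↦ (12, −1)` [tie, odd `5`
bumped]; upward from `−1`: emits `−1`, `(−96, 12) ↦ (−80, −4)`, `(2560, −80) ↦ (2560, −80)`.
[cite: Shewchuk1997, §2.7 p. 332 (COMPRESS), §2.3 Theorem 6] -/
theorem compress_p3_pass2 (he : emin ≤ 0) :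
    compress (roundTiesEven 3 emin) [3, -24, -64, 2560] = [-1, -4, -80, 2560] := by
  have hfl := isRoundNearest_roundTiesEven (p := 3) (emin := emin) (by norm_num)
  obtain ⟨-, -, -, -, f8, -, f3, -, -, f2560, f64, f24, f12, f1, f96, f80, -⟩ := p3_isFloat he
  have F1 : fastTwoSum (roundTiesEven 3 emin) 2560 (-64) = (2560, -64) := by
    rw [f2s_eq' (by norm_num) (s := 2560) hfl f2560 f64 (by norm_num)
      (by rw [show (2560 : ℚ) + -64 = 2496 by norm_num]; exact p3_rne_2496 he)]
    norm_num
  have F2 : fastTwoSum (roundTiesEven 3 emin) (-64) (-24) = (-96, 8) := by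
    rw [f2s_eq' (by norm_num) (s := -96) hfl f64 f24 (by norm_num)
      (by rw [show (-64 : ℚ) + -24 = -88 by norm_num]; exact p3_rne_neg88 he)]
    norm_num
  have F3 : fastTwoSum (roundTiesEven 3 emin) 8 3 = (12, -1) := by
    rw [f2s_eq' (by norm_num) (s := 12) hfl f8 f3 (by norm_num)
      (by rw [show (8 : ℚ) + 3 = 11 by norm_num]; exact p3_rne_11 he)]
    norm_num
  have F4 : fastTwoSum (roundTiesEven 3 emin) 12 (-1) = (12, -1) := by
    rw [f2s_eq' (by norm_num) (s := 12) hfl f12 f1 (by norm_num)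
      (by rw [show (12 : ℚ) + -1 = 11 by norm_num]; exact p3_rne_11 he)]
    norm_num
  have F5 : fastTwoSum (roundTiesEven 3 emin) (-96) 12 = (-80, -4) := by
    rw [f2s_eq' (by norm_num) (s := -80) hfl f96 f12 (by norm_num)
      (by rw [show (-96 : ℚ) + 12 = -84 by norm_num]; exact p3_rne_neg84 he)]
    norm_num
  have F6 : fastTwoSum (roundTiesEven 3 emin) 2560 (-80) = (2560, -80) := by
    rw [f2s_eq' (by norm_num) (s := 2560) hfl f2560 f80 (by norm_num)
      (by rw [show (2560 : ℚ) + -80 = 2480 by norm_num]; exact p3_rne_2480 he)]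
    norm_num
  have hD : compressDown (roundTiesEven 3 emin) 2560 [-64, -24, 3] = ([2560, -96, 12], -1) := by
    rw [compressDown_cons_of_ne_zero (by rw [F1]; norm_num), F1]; simp only
    rw [compressDown_cons_of_ne_zero (by rw [F2]; norm_num), F2]; simp only
    rw [compressDown_cons_of_ne_zero (by rw [F3]; norm_num), F3]
    simp
  have hc : compress (roundTiesEven 3 emin) [3, -24, -64, 2560] =
      compressUp (roundTiesEven 3 emin) (-1) [12, -96, 2560] := by
    simp only [compress, List.reverse_cons, List.reverse_nil, List.nil_append, List.cons_append,
      hD]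
  rw [hc, compressUp_cons_of_ne_zero (by rw [F4]; norm_num), F4]; simp only
  rw [compressUp_cons_of_ne_zero (by rw [F5]; norm_num), F5]; simp only
  rw [compressUp_cons_of_ne_zero (by rw [F6]; norm_num), F6]
  simp

/-- **Pass 3** (`p = 3`, RNE): `COMPRESS⟨−1, −4, −80, 2560⟩ = ⟨−5, −80, 2560⟩`.  Downward:
`(2560, −80) ↦ (2560, −80)`, `(−80, −4) ↦ (−80, −4)`, `(−4, −1) ↦ (−5, 0)` [absorb]; upward from
`−5`: `(−80, −5) ↦ (−80, −5)` emits `−5`, `(2560, −80) ↦ (2560, −80)`.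
[cite: Shewchuk1997, §2.7 p. 332 (COMPRESS), §2.3 Theorem 6] -/
theorem compress_p3_pass3 (he : emin ≤ 0) :
    compress (roundTiesEven 3 emin) [-1, -4, -80, 2560] = [-5, -80, 2560] := by
  have hfl := isRoundNearest_roundTiesEven (p := 3) (emin := emin) (by norm_num)
  obtain ⟨-, -, -, -, -, -, -, -, -, f2560, -, -, -, f1, -, f80, f4, f5⟩ := p3_isFloat he
  have F1 : fastTwoSum (roundTiesEven 3 emin) 2560 (-80) = (2560, -80) := by
    rw [f2s_eq' (by norm_num) (s := 2560) hfl f2560 f80 (by norm_num)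
      (by rw [show (2560 : ℚ) + -80 = 2480 by norm_num]; exact p3_rne_2480 he)]
    norm_num
  have F2 : fastTwoSum (roundTiesEven 3 emin) (-80) (-4) = (-80, -4) := by
    rw [f2s_eq' (by norm_num) (s := -80) hfl f80 f4 (by norm_num)
      (by rw [show (-80 : ℚ) + -4 = -84 by norm_num]; exact p3_rne_neg84 he)]
    norm_num
  have F3 : fastTwoSum (roundTiesEven 3 emin) (-4) (-1) = (-5, 0) := by
    rw [f2s_eq' (by norm_num) (s := -5) hfl f4 f1 (by norm_num)
      (by rw [show (-4 : ℚ) + -1 = -5 by norm_num]; exact roundTiesEven_eq_self (by norm_num) f5)]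
    norm_num
  have F4 : fastTwoSum (roundTiesEven 3 emin) (-80) (-5) = (-80, -5) := by
    rw [f2s_eq' (by norm_num) (s := -80) hfl f80 f5 (by norm_num)
      (by rw [show (-80 : ℚ) + -5 = -85 by norm_num]; exact p3_rne_neg85 he)]
    norm_num
  have hD : compressDown (roundTiesEven 3 emin) 2560 [-80, -4, -1] = ([2560, -80], -5) := by
    rw [compressDown_cons_of_ne_zero (by rw [F1]; norm_num), F1]; simp only
    rw [compressDown_cons_of_ne_zero (by rw [F2]; norm_num), F2]; simp only
    rw [compressDown_cons_of_eq_zero (by rw [F3]), F3]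
    simp
  have hc : compress (roundTiesEven 3 emin) [-1, -4, -80, 2560] =
      compressUp (roundTiesEven 3 emin) (-5) [-80, 2560] := by
    simp only [compress, List.reverse_cons, List.reverse_nil, List.nil_append, List.cons_append,
      hD]
  rw [hc, compressUp_cons_of_ne_zero (by rw [F4]; norm_num), F4]; simp only
  rw [compressUp_cons_of_ne_zero (by rw [F1]; norm_num), F1]
  simp

/-- **COMPRESS may need three passes** (`p = 3`, round-to-nearest-even, `emin ≤ 0`): from the
nonoverlapping all-positive expansion `⟨3, 8, 160, 256, 2048⟩` three successive passes produce
three different expansions `⟨3, −24, −64, 2560⟩`, `⟨−1, −4, −80, 2560⟩`, `⟨−5, −80, 2560⟩`.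
[cite: Shewchuk1997, §2.7 Theorem 23 p. 331–333; BoldoEtAl2023, §2.2] -/
theorem compress_three_passes_prec_three (he : emin ≤ 0) :
    IsExpansion 1 ([3, 8, 160, 256, 2048] : List ℚ) ∧
      (∀ x ∈ ([3, 8, 160, 256, 2048] : List ℚ), IsFloat 3 emin x) ∧
      compress (roundTiesEven 3 emin) [3, 8, 160, 256, 2048] = [3, -24, -64, 2560] ∧
      compress (roundTiesEven 3 emin) [3, -24, -64, 2560] = [-1, -4, -80, 2560] ∧
      compress (roundTiesEven 3 emin) [-1, -4, -80, 2560] = [-5, -80, 2560] := by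
  obtain ⟨f2048, f256, f160, -, f8, -, f3, -⟩ := p3_isFloat he
  refine ⟨p3_isExpansion, ?_, compress_p3_pass1 he, compress_p3_pass2 he, compress_p3_pass3 he⟩
  intro x hx
  simp only [List.mem_cons, List.not_mem_nil, or_false] at hx
  rcases hx with rfl | rfl | rfl | rfl | rfl <;> assumption

/-- **`COMPRESS ∘ COMPRESS` is not idempotent either** (`p = 3`, RNE, `emin ≤ 0`): there is a
round-to-nearest `fl` and a nonoverlapping expansion `e` of floats whose second and third
COMPRESS passes differ — so no fixed number `k ≤ 2` of passes reaches a fixed point in general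
(one pass: `CompressNotIdempotent`; the outputs here even have different lengths `4 ≠ 3`).
[cite: Shewchuk1997, §2.7 Theorem 23 p. 331–333] -/
theorem compress_twice_ne_thrice_prec_three (he : emin ≤ 0) :
    ∃ (fl : ℚ → ℚ) (e : List ℚ), IsRoundNearest 3 emin fl ∧ IsExpansion 1 e ∧
      (∀ x ∈ e, IsFloat 3 emin x) ∧ compress fl e ≠ compress fl (compress fl e) ∧
      compress fl (compress fl e) ≠ compress fl (compress fl (compress fl e)) := by
  obtain ⟨hexp, hfloats, h1, h2, h3⟩ := compress_three_passes_prec_three he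
  refine ⟨roundTiesEven 3 emin, [3, 8, 160, 256, 2048],
    isRoundNearest_roundTiesEven (by norm_num), hexp, hfloats, ?_, ?_⟩
  · rw [h1, h2]; norm_num
  · rw [h1, h2, h3]; simp

end Summit.Ventures.CertifiedArithmetic.Expansions
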